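import Summits.NavierStokesRegularity.NavierStokesRegularity.Theses.TypeIQuarterGate
import Summits.NavierStokesRegularity.NavierStokesRegularity.Theorems.TypeIQuarterGateQuarterLawTypeILinearPacking
import Summits.NavierStokesRegularity.NavierStokesRegularity.Theorems.TypeIQuarterGateQuarterLawTypeIIffUniformCount
import Summits.NavierStokesRegularity.NavierStokesRegularity.Theorems.TypeIQuarterGateLorentzUpgradeIffQuarterLaw
import HarnessLib

/-!
# The CLUSTER LAW form of `TypeIQuarterGate.QuarterLawTypeI` (crux stmt-NavierStokesRegularity-23726)

Helper file (`--supports stmt-NavierStokesRegularity-23726`, def-free), companion of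
`TypeIQuarterGateQuarterLawTypeILinearPacking` (linear packing of `η`-loud vertex-`T` cells under the
sup-norm Type-I rate; clustered ⟹ counted ⟹ quarter law along one solution). Here:

* `clustered_of_quarterLaw` — the converse along one solution: the quarter law `∫‖curl u(t)‖² ≤ K/√(T−t)`
  covers the `η`-loud centres at every scale `r ≤ √T` by `⌊2K⁺/η⌋` balls of radius `2r`
  (`CountQuarterLaw.count_of_quarterLaw` + the packing ⟹ net lemma).
* `quarterLaw_iff_clustered` — per Type-I blow-up: slice quarter law ⟺ cluster law.
* BY NAME: `quarterLawTypeI_iff_clusterLaw`, `lorentzUpgradeTypeI_iff_clusterLaw` (the registered open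
  stub `stub_lorentzUpgrade` = crux stmt-24108), `uniformConcentrationCountTypeI_iff_clusterLaw`
  (stmt-23970): the three coincident Type-I cruxes of the route ⟺ «for every `η` the `η`-loud vertex-`T`
  cells at scale `r` are covered by `k(η)` balls of radius `A(η)·r`, uniformly in small `r`».
* `violator_unclustered` — a violator of K1 has, for one `η > 0`, loud cells escaping every `k` balls of
  radius `A r` at arbitrarily small scales (for all `k`, `A`); with the linear packing (≤ `3M(A+1)/η`
  separated loud cells per ball of radius `A r`) its loud set has unbounded parabolic extent /
  unboundedly many clusters — the «collapsing filament / spark cloud» enemy, never finitely many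
  Type-I-size clusters.

HONEST FRAMING: equivalences between OPEN statements about hypothetical Type-I blow-ups and a portrait
of a hypothetical violator; K1, 24108, 23970 and NS regularity remain OPEN; nothing about the summit is
claimed. [folklore] [cite: Seregin2014, Ch. 6 §6.3 Prop. 3.11 (i)] [cite: CaffarelliKohnNirenberg1982, §6]
-/

-- the summit-side namespace repeats a component by design (D-0017)
set_option linter.dupNamespace false

noncomputable section

namespace Summit.NavierStokesRegularity.NavierStokesRegularity.Theorems

namespace QuarterLawLinearPacking

open Set MeasureTheory Function Metric Filter Topology
open scoped ENNReal NNReal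
open Literature.Analysis.FluidPDE
open Summit.NavierStokesRegularity.NavierStokesRegularity.Theses.TypeIQuarterGate
  (QuarterLawTypeI LorentzUpgradeTypeI UniformConcentrationCountTypeI)

variable {ν T : ℝ} {u : ℝ → EuclideanSpace ℝ (Fin 3) → EuclideanSpace ℝ (Fin 3)}
  {p : ℝ → EuclideanSpace ℝ (Fin 3) → ℝ}

/-! ### 4. The converse and the by-name cluster law -/

/-- **Quarter law ⟹ clustered**, along one solution: if `∫‖curl u(t)‖² ≤ K/√(T−t)` on `[0,T)` (classical
solution on `[0,T)`, `ν > 0`, Leray–Hopf), then for every `η > 0` the `η`-loud centres at every scale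
`0 < r ≤ √T` are covered by at most `⌊2K⁺/η⌋` balls of radius `2r` (`count_of_quarterLaw` +
`clustered_of_count`). [folklore] -/
theorem clustered_of_quarterLaw (hν : 0 < ν) (hT : 0 < T)
    (hsol : IsClassicalNSSolutionOn (Ico 0 T) ν 0 u p) (hLH : IsLerayHopfOn T ν 0 (u 0) u)
    {K : ℝ} (hq : ∀ t ∈ Ico 0 T, ∫⁻ x, ‖curl (u t) x‖ₑ ^ 2 ≤ ENNReal.ofReal (K / Real.sqrt (T - t))) :
    ∀ η : ℝ, 0 < η → ∃ (k : ℕ) (A r₁ : ℝ), 0 ≤ A ∧ 0 < r₁ ∧ ∀ r : ℝ, 0 < r → r ≤ r₁ →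
      ∃ c : Finset (EuclideanSpace ℝ (Fin 3)), c.card ≤ k ∧
        ∀ x : EuclideanSpace ℝ (Fin 3),
          ENNReal.ofReal (η * r) ≤ ∫⁻ s in Ioo (T - r ^ 2) T, ∫⁻ y in ball x r,
            ENNReal.ofReal (frobeniusNormSq (fderiv ℝ (u s) y)) → ∃ x₀ ∈ c, ‖x - x₀‖ ≤ A * r := by
  intro η hη
  refine ⟨⌊2 * max K 0 / η⌋₊, 2, Real.sqrt T, by norm_num, Real.sqrt_pos.2 hT, fun r hr hrT => ?_⟩
  exact clustered_of_count (T := T) (u := u) hr fun σ hsep hconc =>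
    CountQuarterLaw.count_of_quarterLaw hν hT hsol hLH hq hη hr hrT σ hsep hconc

/-- **Quarter law ⟺ cluster law, along one Type-I blow-up** (hypotheses of K1): the slice quarter law
`∃ K, ∀ t ∈ [0,T), ∫‖curl u(t)‖² ≤ K/√(T−t)` holds iff for every `η > 0` the `η`-loud vertex-`T` cells at
scale `r` are covered by `k(η)` balls of radius `A(η)·r`, uniformly in `0 < r ≤ r₁(η)`. [folklore] -/
theorem quarterLaw_iff_clustered (hν : 0 < ν) (hT : 0 < T)
    (hmax : IsMaximalSmoothSolution ν 0 u p T) (hLH : IsLerayHopfOn T ν 0 (u 0) u)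
    (hdec : HasRapidSpatialDecay (u 0)) (hI : IsTypeIBlowup u T) :
    (∃ K : ℝ, ∀ t ∈ Ico 0 T,
      ∫⁻ x, ‖curl (u t) x‖ₑ ^ 2 ≤ ENNReal.ofReal (K / Real.sqrt (T - t))) ↔
    ∀ η : ℝ, 0 < η → ∃ (k : ℕ) (A r₁ : ℝ), 0 ≤ A ∧ 0 < r₁ ∧ ∀ r : ℝ, 0 < r → r ≤ r₁ →
      ∃ c : Finset (EuclideanSpace ℝ (Fin 3)), c.card ≤ k ∧
        ∀ x : EuclideanSpace ℝ (Fin 3),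
          ENNReal.ofReal (η * r) ≤ ∫⁻ s in Ioo (T - r ^ 2) T, ∫⁻ y in ball x r,
            ENNReal.ofReal (frobeniusNormSq (fderiv ℝ (u s) y)) → ∃ x₀ ∈ c, ‖x - x₀‖ ≤ A * r :=
  ⟨fun ⟨_, hq⟩ => clustered_of_quarterLaw hν hT hmax.1 hLH hq,
    quarterLaw_of_clustered hν hT hmax hLH hdec hI⟩

/-- **`QuarterLawTypeI` ⟺ the CLUSTER LAW on Type-I blow-ups** (crux stmt-23726 re-read geometrically):
K1 holds iff along every Type-I blow-up of its class, for every `η > 0`, the `η`-loud vertex-`T` cells at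
scale `r` are covered by boundedly many balls of radius `O(r)`, uniformly in the small scale `r`. An
equivalence of OPEN statements; neither side is asserted. [folklore] -/
theorem quarterLawTypeI_iff_clusterLaw :
    QuarterLawTypeI ↔
    ∀ (ν T : ℝ), 0 < ν → 0 < T → ∀ (u : ℝ → EuclideanSpace ℝ (Fin 3) → EuclideanSpace ℝ (Fin 3))
      (p : ℝ → EuclideanSpace ℝ (Fin 3) → ℝ), IsMaximalSmoothSolution ν 0 u p T →
      IsLerayHopfOn T ν 0 (u 0) u → HasRapidSpatialDecay (u 0) → IsTypeIBlowup u T →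
      ∀ η : ℝ, 0 < η → ∃ (k : ℕ) (A r₁ : ℝ), 0 ≤ A ∧ 0 < r₁ ∧ ∀ r : ℝ, 0 < r → r ≤ r₁ →
        ∃ c : Finset (EuclideanSpace ℝ (Fin 3)), c.card ≤ k ∧
          ∀ x : EuclideanSpace ℝ (Fin 3),
            ENNReal.ofReal (η * r) ≤ ∫⁻ s in Ioo (T - r ^ 2) T, ∫⁻ y in ball x r,
              ENNReal.ofReal (frobeniusNormSq (fderiv ℝ (u s) y)) → ∃ x₀ ∈ c, ‖x - x₀‖ ≤ A * r := by
  unfold Summit.NavierStokesRegularity.NavierStokesRegularity.Theses.TypeIQuarterGate.QuarterLawTypeI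
  constructor
  · intro hK ν T hν hT u p hmax hLH hdec hI
    exact (quarterLaw_iff_clustered hν hT hmax hLH hdec hI).1 (hK ν T hν hT u p hmax hLH hdec hI)
  · intro hC ν T hν hT u p hmax hLH hdec hI
    exact (quarterLaw_iff_clustered hν hT hmax hLH hdec hI).2 (hC ν T hν hT u p hmax hLH hdec hI)

/-- **`LorentzUpgradeTypeI` (open stub `stub_lorentzUpgrade` = crux stmt-24108) ⟺ the CLUSTER LAW** — via
the tree's `lorentzUpgradeTypeI_iff_quarterLawTypeI`. An equivalence of OPEN statements. [folklore] -/
theorem lorentzUpgradeTypeI_iff_clusterLaw :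
    LorentzUpgradeTypeI ↔
    ∀ (ν T : ℝ), 0 < ν → 0 < T → ∀ (u : ℝ → EuclideanSpace ℝ (Fin 3) → EuclideanSpace ℝ (Fin 3))
      (p : ℝ → EuclideanSpace ℝ (Fin 3) → ℝ), IsMaximalSmoothSolution ν 0 u p T →
      IsLerayHopfOn T ν 0 (u 0) u → HasRapidSpatialDecay (u 0) → IsTypeIBlowup u T →
      ∀ η : ℝ, 0 < η → ∃ (k : ℕ) (A r₁ : ℝ), 0 ≤ A ∧ 0 < r₁ ∧ ∀ r : ℝ, 0 < r → r ≤ r₁ →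
        ∃ c : Finset (EuclideanSpace ℝ (Fin 3)), c.card ≤ k ∧
          ∀ x : EuclideanSpace ℝ (Fin 3),
            ENNReal.ofReal (η * r) ≤ ∫⁻ s in Ioo (T - r ^ 2) T, ∫⁻ y in ball x r,
              ENNReal.ofReal (frobeniusNormSq (fderiv ℝ (u s) y)) → ∃ x₀ ∈ c, ‖x - x₀‖ ≤ A * r :=
  LorentzOfEnvelope.lorentzUpgradeTypeI_iff_quarterLawTypeI.trans quarterLawTypeI_iff_clusterLaw

/-- **`UniformConcentrationCountTypeI` (crux stmt-23970) ⟺ the CLUSTER LAW** — via the tree's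
`quarterLawTypeI_iff_uniformConcentrationCountTypeI`. An equivalence of OPEN statements. [folklore] -/
theorem uniformConcentrationCountTypeI_iff_clusterLaw :
    UniformConcentrationCountTypeI ↔
    ∀ (ν T : ℝ), 0 < ν → 0 < T → ∀ (u : ℝ → EuclideanSpace ℝ (Fin 3) → EuclideanSpace ℝ (Fin 3))
      (p : ℝ → EuclideanSpace ℝ (Fin 3) → ℝ), IsMaximalSmoothSolution ν 0 u p T →
      IsLerayHopfOn T ν 0 (u 0) u → HasRapidSpatialDecay (u 0) → IsTypeIBlowup u T →
      ∀ η : ℝ, 0 < η → ∃ (k : ℕ) (A r₁ : ℝ), 0 ≤ A ∧ 0 < r₁ ∧ ∀ r : ℝ, 0 < r → r ≤ r₁ →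
        ∃ c : Finset (EuclideanSpace ℝ (Fin 3)), c.card ≤ k ∧
          ∀ x : EuclideanSpace ℝ (Fin 3),
            ENNReal.ofReal (η * r) ≤ ∫⁻ s in Ioo (T - r ^ 2) T, ∫⁻ y in ball x r,
              ENNReal.ofReal (frobeniusNormSq (fderiv ℝ (u s) y)) → ∃ x₀ ∈ c, ‖x - x₀‖ ≤ A * r :=
  CountQuarterLaw.quarterLawTypeI_iff_uniformConcentrationCountTypeI.symm.trans
    quarterLawTypeI_iff_clusterLaw

/-! ### 5. Shape of a violator -/

/-- **A violator's loud set is unclustered.** Along a Type-I blow-up of K1's class that violates the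
quarter law there is a threshold `η > 0` such that for EVERY `k`, `A ≥ 0` and `r₁ > 0` some scale
`0 < r ≤ r₁` has `η`-loud cells escaping every `k` balls of radius `A r`: together with the linear packing
`linearPacking_of_isTypeIBlowup` (at most `3M(A+1)/η` separated loud cells per ball of radius `A r`), the
loud set of a violator has unbounded parabolic extent / unboundedly many clusters — never finitely many
clusters of Type-I size. A statement about hypothetical objects. [folklore] -/
theorem violator_unclustered (hν : 0 < ν) (hT : 0 < T)
    (hmax : IsMaximalSmoothSolution ν 0 u p T) (hLH : IsLerayHopfOn T ν 0 (u 0) u)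
    (hdec : HasRapidSpatialDecay (u 0)) (hI : IsTypeIBlowup u T)
    (hviol : ¬ ∃ K : ℝ, ∀ t ∈ Ico 0 T,
      ∫⁻ x, ‖curl (u t) x‖ₑ ^ 2 ≤ ENNReal.ofReal (K / Real.sqrt (T - t))) :
    ∃ η : ℝ, 0 < η ∧ ∀ (k : ℕ) (A r₁ : ℝ), 0 ≤ A → 0 < r₁ → ∃ r : ℝ, 0 < r ∧ r ≤ r₁ ∧
      ∀ c : Finset (EuclideanSpace ℝ (Fin 3)), c.card ≤ k →
        ∃ x : EuclideanSpace ℝ (Fin 3),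
          ENNReal.ofReal (η * r) ≤ ∫⁻ s in Ioo (T - r ^ 2) T, ∫⁻ y in ball x r,
            ENNReal.ofReal (frobeniusNormSq (fderiv ℝ (u s) y)) ∧ ∀ x₀ ∈ c, A * r < ‖x - x₀‖ := by
  by_contra h
  push Not at h
  refine hviol (quarterLaw_of_clustered hν hT hmax hLH hdec hI fun η hη => ?_)
  obtain ⟨k, A, r₁, hA, hr₁, hkA⟩ := h η hη
  refine ⟨k, A, r₁, hA, hr₁, fun r hr hrle => ?_⟩
  obtain ⟨c, hck, hc⟩ := hkA r hr hrle
  exact ⟨c, hck, fun x hx => hc x hx⟩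

end QuarterLawLinearPacking

end Summit.NavierStokesRegularity.NavierStokesRegularity.Theorems

end
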